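import Summits.BirchSwinnertonDyer.Rank1Residual.Additive.KummerDeuringModel
import HarnessLib

/-!
# The Kummer–Deuring good model with its Kummer element EXPORTED: `u^e = p^m`, `gcd(m, e) = 1`,
# `σ(C) = ⟨σu/u, 0, 0, 0⟩ · C`, and `σ^k u = ζ_σ^k u` for inertial `σ`
# (cell `b2b-bsdres`, team n1011, seat p16 (gen 7); row T-QEXP FILE Q1 — the input of the
# (P-e46-odd) producer `Additive/RamifiedOrdinaryLineHalfPower.lean`)

HONEST FRAMING (cell `b2b-bsdres`, run/shared/lean/b2b/bsd-rank1-residual/, verbatim in every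
file): the goal of the cell is to DELETE the COMBINATION-SHAPED residual classes of the
Birch–Swinnerton-Dyer formula for ALL analytic-rank `≤ 1` elliptic curves over `ℚ` — "full BSD
formula for every rank `≤ 1` curve in class `C`" assembled STRICTLY from published theorems — so
that the rank-`≤ 1` remainder becomes exactly the CONSTRUCTION-SHAPED classes, which are TYPED
(missing-input `Prop`s), NOT attempted. This is not "finishing BSD". Team n1011 (N10/N11): research
route on the CONSTRUCTION-SHAPED classes X3♯(G-ord)/X4♯(G-ord); prove what is provable now; no
claim beyond stated classes; census output = EVIDENCE, never a Literature fact; RESIDUAL-MAP marks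
UNCHANGED; nothing is booked by this file. TOOL theorems only: NO definition, NO named fact, NO
conjecture node.

## What and why

p07's FILE A2 `exists_kummerGoodModel` (row T-ROL-EXP) produces, for `E/ℚ` globally minimal with
`ord_p j ≥ 0` at `p ≥ 5`, a good model `W₀ = C • E ⊗ K̄_v` whose change of variables is fixed by
`σ^e` for every local inertia element `σ` (`e` the semistability defect) — and HIDES the Kummer
element `u` (`u^e = p^m`) inside the `∃`. The (P-e46-odd) producer (class-closure
`N10/TRANSPORT-TEMPLATE.md` v2.1 §PRODUCERS; S4's `hℓ` at `(p−1)/2`) needs the element itself: the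
quadratic part of the quotient character is read off `σ(u^{e/2})/u^{e/2}`. This file re-runs A2's
construction (verbatim, Silverman *AEC* VII.5.5 made explicit) keeping the data:

* §1 arithmetic of `e = 12/gcd(12, ord_pΔ)` and `m = ord_pΔ/gcd(12, ord_pΔ)`:
  `coprime_semistabilityIndex_div_gcd` (`gcd(e, m) = 1`) and
  `odd_div_gcd_of_two_dvd_semistabilityIndex` (`e` even ⟹ `m` odd);
* §2 **`exists_kummerGoodModel_explicit`** — `∃ u C W₀`, `u ≠ 0`, `u^e = p^m`,
  `C • E ⊗ K̄_v = W₀ ⊗ K̄_v`, `IsUnit W₀.Δ`, `W₀` SHORT (`a₁ = a₂ = a₃ = 0`), and for EVERY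
  `ψ ∈ Aut(K̄_v/ℚ_v)` and unit `η` with `ψ u = η u`: `C.map ψ = ⟨η, 0, 0, 0⟩ · C` (the other three
  entries of `C` are rational);
* §3 **`exists_rootOfUnity_pow_smul_eq`** — for `σ` in the local inertia group and `u^e = p^m`,
  `p ∤ e`: the `e`-th root of unity `ζ = σu/u` is a `|·|_v`-unit FIXED by `σ`, and `σ^k u = ζ^k u`
  for every `k` (the internal steps of A1 `pow_smul_eq_of_pow_eq_natCast_pow`, exported).

References: J. H. Silverman, *AEC* 2nd ed. VII.5.5 [SilvermanAEC2009]; J.-P. Serre, Invent. Math.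
15 (1972) §5.6 p. 312 [Serre1972]; J.-P. Serre, J. Tate, Ann. of Math. 88 (1968) §2
[SerreTate1968]; cells/n1011/skel/T-QEXP.md; p07's `Additive/KummerDeuringModel.lean` (A2) and
`Additive/InertiaKummerRootOfUnity.lean` (A1), whose proofs are re-run here with the data kept.
-/

set_option autoImplicit false

noncomputable section

open scoped Classical NNReal NumberField

open WeierstrassCurve

universe u

namespace Summit.BirchSwinnertonDyer.Rank1Residual.Additive.GoodModelLine

open NumberField IsDedekindDomain Field IsDedekindDomain.HeightOneSpectrum
  Literature.NumberTheory.GaloisRepresentations Literature.NumberTheory.EllipticCurves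
  Literature.NumberTheory.EllipticCurves.GreenbergSelmer
  Literature.NumberTheory.EllipticCurves.Rank1Residual
  Summit.BirchSwinnertonDyer.Rank1Residual.X2.GreenbergVatsalReductionDatum

section Arithmetic

variable (p : ℕ) (W : WeierstrassCurve ℚ) [W.IsGloballyMinimal]

/-! ## §1 `gcd(e, m) = 1`, and `m` is odd when `e` is even -/

/-- **`gcd(e, m) = 1`** for `e = 12/g`, `m = ord_pΔ/g`, `g = gcd(12, ord_pΔ)`. [folklore] -/
theorem coprime_semistabilityIndex_div_gcd :
    Nat.Coprime (semistabilityIndex W p)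
      (padicValInt p W.minimalDiscriminantInt / Nat.gcd 12 (padicValInt p W.minimalDiscriminantInt)) :=
  Nat.coprime_div_gcd_div_gcd (Nat.gcd_pos_of_pos_left _ (by norm_num))

/-- **`e` even ⟹ `m` odd** (`gcd(e, m) = 1`). [folklore] -/
theorem odd_div_gcd_of_two_dvd_semistabilityIndex (h2e : 2 ∣ semistabilityIndex W p) :
    Odd (padicValInt p W.minimalDiscriminantInt / Nat.gcd 12 (padicValInt p W.minimalDiscriminantInt)) := by
  rw [Nat.odd_iff]
  by_contra h
  have h2m : 2 ∣ padicValInt p W.minimalDiscriminantInt /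
      Nat.gcd 12 (padicValInt p W.minimalDiscriminantInt) := Nat.dvd_of_mod_eq_zero (by omega)
  have h21 : 2 ∣ 1 := by
    have h := Nat.dvd_gcd h2e h2m
    rwa [(coprime_semistabilityIndex_div_gcd p W).gcd_eq_one] at h
  omega

end Arithmetic

section Local

variable (p : ℕ) [hp : Fact p.Prime] {v : HeightOneSpectrum (𝓞 ℚ)}

/-! ## §2 The explicit Kummer–Deuring good model, data exported -/

variable (W : WeierstrassCurve ℚ) [W.IsElliptic] [W.IsGloballyMinimal]

/-- `⟨η, 0, 0, 0⟩ · ⟨u, r, s, t⟩ = ⟨η u, r, s, t⟩`: a pure rescaling composed AFTER a change of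
variables only rescales its unit. [folklore] -/
theorem variableChange_smulUnit_mul {R : Type*} [CommRing R] (η : Rˣ) (C : VariableChange R) :
    (⟨η, 0, 0, 0⟩ : VariableChange R) * C = ⟨η * C.u, C.r, C.s, C.t⟩ := by
  rw [VariableChange.mul_def]
  ext <;> simp

/-- **THE KUMMER–DEURING GOOD MODEL, WITH ITS KUMMER ELEMENT.** `E/ℚ` globally minimal, `p ≥ 5`,
`v ∋ p`, `ord_p j(E) ≥ 0`, `e = semistabilityIndex W p = 12/gcd(12, ord_pΔ)`,
`m = ord_pΔ/gcd(12, ord_pΔ)`. There are `u ∈ K̄_v`, a change of variables `C` over `K̄_v` and a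
Weierstrass equation `W₀` over the valuation ring `𝒪_w` of the spectral valuation with:
`u ≠ 0`, `u^e = p^m`, `C • E ⊗ K̄_v = W₀ ⊗ K̄_v`, `Δ(W₀)` a unit, `W₀` in SHORT form
(`a₁ = a₂ = a₃ = 0`), and `C = ⟨u, r, s, t⟩` with `r, s, t ∈ ℚ`, recorded as: for every
`ψ ∈ Aut(K̄_v/ℚ_v)` and every unit `η` with `ψ(u) = η u`, `ψ(C) = ⟨η, 0, 0, 0⟩ · C`. This is p07's
A2 `exists_kummerGoodModel` (Silverman *AEC* VII.5.5 made explicit: `C = ⟨u, 0, 0, 0⟩ · toShortNF E`,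
integrality of `a₄/u⁴`, `a₆/u⁶` from `|c₄|³ ≤ |Δ|`, `|c₆|² ≤ |Δ|`, `|u|^{12} = |Δ|`) with the data
kept instead of hidden in the `∃`. [cite: SilvermanAEC2009, Prop. VII.5.5]
[cite: Serre1972, §5.6 (p. 312)] -/
theorem exists_kummerGoodModel_explicit (hp5 : 5 ≤ p) (hpv : ((p : ℕ) : 𝓞 ℚ) ∈ v.asIdeal)
    (hj : 0 ≤ padicValRat p W.j) :
    ∃ (u : AlgebraicClosure (v.adicCompletion ℚ))
      (C : VariableChange (AlgebraicClosure (v.adicCompletion ℚ)))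
      (W₀ : WeierstrassCurve (specVal v).integer),
      u ≠ 0 ∧
      u ^ semistabilityIndex W p = ((p : ℕ) : AlgebraicClosure (v.adicCompletion ℚ)) ^
        (padicValInt p W.minimalDiscriminantInt / Nat.gcd 12 (padicValInt p W.minimalDiscriminantInt)) ∧
      C • (W.baseChange (v.adicCompletion ℚ)).baseChange (AlgebraicClosure (v.adicCompletion ℚ)) =
        W₀.baseChange (AlgebraicClosure (v.adicCompletion ℚ)) ∧ IsUnit W₀.Δ ∧
      W₀.a₁ = 0 ∧ W₀.a₂ = 0 ∧ W₀.a₃ = 0 ∧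
      ∀ (ψ : AlgebraicClosure (v.adicCompletion ℚ) ≃ₐ[v.adicCompletion ℚ]
          AlgebraicClosure (v.adicCompletion ℚ)) (η : (AlgebraicClosure (v.adicCompletion ℚ))ˣ),
        ψ u = η * u →
          C.map (ψ : AlgebraicClosure (v.adicCompletion ℚ) →+* AlgebraicClosure (v.adicCompletion ℚ)) =
            (⟨η, 0, 0, 0⟩ : VariableChange (AlgebraicClosure (v.adicCompletion ℚ))) * C := by
  -- adapted from p07's A2 `exists_kummerGoodModel` (same construction, data exported)
  set L := AlgebraicClosure (v.adicCompletion ℚ)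
  set w := specVal v with hw
  set φ : ℚ →+* L := algebraMap ℚ L with hφ
  haveI : CharZero L := charZero_of_injective_algebraMap (algebraMap ℚ L).injective
  have hvO : w.Integers w.integer := Valuation.integer.integers _
  -- the exponent data
  set n : ℕ := padicValInt p W.minimalDiscriminantInt with hn
  set g : ℕ := Nat.gcd 12 n with hg
  set e : ℕ := semistabilityIndex W p with hedef
  set m : ℕ := n / g with hm
  have heg : e * g = 12 := semistabilityIndex_mul_gcd p W
  have hmg : m * g = n := Nat.div_mul_cancel (Nat.gcd_dvd_right _ _)
  have he0 : e ≠ 0 := semistabilityIndex_ne_zero p W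
  -- the Kummer element `u`, `u ^ e = p ^ m`
  have hp0 : (p : L) ≠ 0 := Nat.cast_ne_zero.mpr hp.out.ne_zero
  obtain ⟨u, hu⟩ := IsAlgClosed.exists_pow_nat_eq ((p : L) ^ m) (Nat.pos_of_ne_zero he0)
  have hu0 : u ≠ 0 := by
    intro h; rw [h, zero_pow he0] at hu; exact pow_ne_zero m hp0 hu.symm
  -- valuations
  set q : ℝ≥0 := w (p : L) with hq
  have hwu : w u ^ e = q ^ m := by rw [← map_pow, hu, map_pow]
  have hwu12 : w u ^ 12 = w (φ W.Δ) := by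
    rw [hφ, specVal_Δ_eq_pow p W hpv, ← hn, ← hw, ← hq, ← heg, pow_mul, hwu, ← pow_mul, hmg]
  have hwu0 : w u ≠ 0 := (Valuation.ne_zero_iff _).mpr hu0
  have hc4 : w (φ W.c₄) ≤ w u ^ 4 := by
    have h := specVal_c₄_pow_three_le p W hpv hj
    rw [← hφ, ← hw, ← hwu12, show w u ^ 12 = (w u ^ 4) ^ 3 by ring] at h
    exact le_of_pow_le_pow_left₀ three_ne_zero (by positivity) h
  have hc6 : w (φ W.c₆) ≤ w u ^ 6 := by
    have h := specVal_c₆_sq_le p W hpv hj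
    rw [← hφ, ← hw, ← hwu12, show w u ^ 12 = (w u ^ 6) ^ 2 by ring] at h
    exact le_of_pow_le_pow_left₀ two_ne_zero (by positivity) h
  -- units `48`, `864` at `v` (`p ≥ 5`)
  have h2 : ¬ (p : ℤ) ∣ 2 := by
    intro h
    have := Int.le_of_dvd (by norm_num) h
    have : (p : ℤ) ≥ 5 := by exact_mod_cast hp5
    omega
  have h3 : ¬ (p : ℤ) ∣ 3 := by
    intro h
    have := Int.le_of_dvd (by norm_num) h
    have : (p : ℤ) ≥ 5 := by exact_mod_cast hp5
    omega
  have hpZ : Prime (p : ℤ) := Nat.prime_iff_prime_int.mp hp.out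
  have h48 : w (48 : L) = 1 := by
    have h : ¬ (p : ℤ) ∣ 48 := by
      intro hd
      rw [show (48 : ℤ) = 2 ^ 4 * 3 by norm_num] at hd
      rcases hpZ.dvd_or_dvd hd with hd | hd
      · exact h2 (hpZ.dvd_of_dvd_pow hd)
      · exact h3 hd
    have := spectralValuation_intCast_eq_one_of_natCast_mem hpv (specVal_spec v) (n := 48) h
    exact_mod_cast this
  have h864 : w (864 : L) = 1 := by
    have h : ¬ (p : ℤ) ∣ 864 := by
      intro hd
      rw [show (864 : ℤ) = 2 ^ 5 * 3 ^ 3 by norm_num] at hd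
      rcases hpZ.dvd_or_dvd hd with hd | hd
      · exact h2 (hpZ.dvd_of_dvd_pow hd)
      · exact h3 (hpZ.dvd_of_dvd_pow hd)
    have := spectralValuation_intCast_eq_one_of_natCast_mem hpv (specVal_spec v) (n := 864) h
    exact_mod_cast this
  -- the short normal form over `ℚ`
  haveI : Invertible (2 : ℚ) := invertibleOfNonzero two_ne_zero
  haveI : Invertible (3 : ℚ) := invertibleOfNonzero three_ne_zero
  set Cs : VariableChange ℚ := W.toShortNF with hCs
  haveI hNF : (Cs • W).IsShortNF := W.toShortNF_spec
  have hCsu : Cs.u = 1 := by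
    rw [hCs, WeierstrassCurve.toShortNF, VariableChange.mul_def]
    simp [WeierstrassCurve.toCharNeTwoNF]
  have hs_c₄ : (Cs • W).c₄ = W.c₄ := by rw [variableChange_c₄, hCsu]; simp
  have hs_c₆ : (Cs • W).c₆ = W.c₆ := by rw [variableChange_c₆, hCsu]; simp
  have ha₄ : (Cs • W).a₄ = -W.c₄ / 48 := by
    have h := c₄_of_isShortNF (Cs • W)
    rw [hs_c₄] at h
    field_simp
    linarith
  have ha₆ : (Cs • W).a₆ = -W.c₆ / 864 := by
    have h := c₆_of_isShortNF (Cs • W)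
    rw [hs_c₆] at h
    field_simp
    linarith
  -- integrality of the scaled coefficients
  have hwsa₄ : w (φ (Cs • W).a₄) = w (φ W.c₄) := by
    rw [ha₄, map_div₀, map_neg, map_div₀, Valuation.map_neg, map_ofNat φ 48, h48, div_one]
  have hwsa₆ : w (φ (Cs • W).a₆) = w (φ W.c₆) := by
    rw [ha₆, map_div₀, map_neg, map_div₀, Valuation.map_neg, map_ofNat φ 864, h864, div_one]
  have hwa₄ : w (u⁻¹ ^ 4 * φ (Cs • W).a₄) ≤ 1 := by
    rw [map_mul, map_pow, map_inv₀, hwsa₄]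
    calc (w u)⁻¹ ^ 4 * w (φ W.c₄) ≤ (w u)⁻¹ ^ 4 * w u ^ 4 := mul_le_mul' le_rfl hc4
      _ = 1 := by rw [← mul_pow, inv_mul_cancel₀ hwu0, one_pow]
  have hwa₆ : w (u⁻¹ ^ 6 * φ (Cs • W).a₆) ≤ 1 := by
    rw [map_mul, map_pow, map_inv₀, hwsa₆]
    calc (w u)⁻¹ ^ 6 * w (φ W.c₆) ≤ (w u)⁻¹ ^ 6 * w u ^ 6 := mul_le_mul' le_rfl hc6
      _ = 1 := by rw [← mul_pow, inv_mul_cancel₀ hwu0, one_pow]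
  -- the model
  set Cu : VariableChange L := ⟨Units.mk0 u hu0, 0, 0, 0⟩ with hCu
  set C : VariableChange L := Cu * Cs.map φ with hC
  set W₀ : WeierstrassCurve w.integer :=
    ⟨0, 0, 0, ⟨u⁻¹ ^ 4 * φ (Cs • W).a₄, hwa₄⟩, ⟨u⁻¹ ^ 6 * φ (Cs • W).a₆, hwa₆⟩⟩ with hW₀
  have hX : (W.baseChange (v.adicCompletion ℚ)).baseChange L = W.map φ := by
    rw [baseChange_baseChange_adicCompletion]; rfl
  have hCuu : ((Cu.u⁻¹ : Lˣ) : L) = u⁻¹ := by rw [hCu, Units.val_inv_eq_inv_val, Units.val_mk0]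
  have hmodel : C • (W.baseChange (v.adicCompletion ℚ)).baseChange L = W₀.baseChange L := by
    rw [hX, hC, mul_smul, map_variableChange]
    ext
    · simp [variableChange_a₁, hCu, hW₀]
    · simp [variableChange_a₂, hCu, hW₀]
    · simp [variableChange_a₃, hCu, hW₀]
    · rw [variableChange_a₄, hCuu]
      simp [hCu, hW₀]
      rfl
    · rw [variableChange_a₆, hCuu]
      simp [hCu, hW₀]
      rfl
  refine ⟨u, C, W₀, hu0, hu, hmodel, ?_, rfl, rfl, rfl, fun ψ η hψu ↦ ?_⟩
  · -- unit discriminant: `Δ(W₀) = Δ/u^{12}`, `|u|^{12} = |Δ|`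
    apply hvO.isUnit_of_one
    · exact isUnit_iff_ne_zero.mpr (by
        intro h0
        have h : (W₀.baseChange L).Δ = 0 := by rw [baseChange, map_Δ]; exact h0
        rw [← hmodel, variableChange_Δ, hX, map_Δ] at h
        exact (mul_ne_zero (pow_ne_zero _ (Units.ne_zero _)) ((map_ne_zero φ).mpr W.isUnit_Δ.ne_zero)) h)
    · have hCval : ((C.u⁻¹ : Lˣ) : L) = u⁻¹ := by
        rw [Units.val_inv_eq_inv_val, hC, VariableChange.mul_def]
        simp [hCu, hCsu]
      have h : w (W₀.baseChange L).Δ = 1 := by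
        rw [← hmodel, variableChange_Δ, hX, map_Δ, hCval, map_mul, map_pow, map_inv₀, ← hwu12, ← mul_pow,
          inv_mul_cancel₀ hwu0, one_pow]
      rw [baseChange, map_Δ] at h
      exact h
  · -- `ψ(C) = ⟨η, 0, 0, 0⟩ · C`: `ψ u = η u`, and `r, s, t ∈ ℚ` are fixed
    have hψφ : (ψ : L →+* L).comp φ = φ := Subsingleton.elim _ _
    have hCs' : (Cs.map φ).map (ψ : L →+* L) = Cs.map φ := by
      rw [VariableChange.map_map, hψφ]
    have hCu' : Cu.map (ψ : L →+* L) = (⟨η, 0, 0, 0⟩ : VariableChange L) * Cu := by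
      rw [variableChange_smulUnit_mul, hCu]
      ext
      · simp [VariableChange.map, hψu]
      · simp [VariableChange.map]
      · simp [VariableChange.map]
      · simp [VariableChange.map]
    rw [hC, show (Cu * Cs.map φ).map (ψ : L →+* L) = Cu.map (ψ : L →+* L) * (Cs.map φ).map (ψ : L →+* L)
      from map_mul (VariableChange.mapHom (ψ : L →+* L)) Cu (Cs.map φ), hCu', hCs', mul_assoc]

/-! ## §3 The `e`-th root of unity `ζ_σ = σ(u)/u` of an inertial `σ`, fixed by `σ` -/

omit [W.IsElliptic] [W.IsGloballyMinimal] in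
/-- **For `σ` in the local inertia group and `u^e = p^m` (`p ∤ e`): `ζ = σ(u)/u` is an `e`-th root of
unity of valuation `1`, FIXED by `σ`, and `σ^k(u) = ζ^k u` for every `k`.** (`σ(ζ)/ζ` is an `e`-th
root of unity `≡ 1 (mod 𝔪)`, hence `1` by A1 `eq_one_of_pow_eq_one_of_specVal_sub_one_lt`.) The
internal steps of p07's A1 `pow_smul_eq_of_pow_eq_natCast_pow`, exported. [folklore] -/
theorem exists_rootOfUnity_pow_smul_eq (hpv : ((p : ℕ) : 𝓞 ℚ) ∈ v.asIdeal)
    {u : AlgebraicClosure (v.adicCompletion ℚ)} {e m : ℕ} (he0 : e ≠ 0) (hpe : ¬ p ∣ e)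
    (hu : u ^ e = (p : AlgebraicClosure (v.adicCompletion ℚ)) ^ m)
    {σ : absoluteGaloisGroup (v.adicCompletion ℚ)} (hσ : σ ∈ absInertia (v.adicCompletion ℚ)) :
    ∃ ζ : AlgebraicClosure (v.adicCompletion ℚ), ζ ^ e = 1 ∧ specVal v ζ = 1 ∧ σ • ζ = ζ ∧
      ∀ k : ℕ, (σ ^ k) • u = ζ ^ k * u := by
  -- adapted from p07's A1 `pow_smul_eq_of_pow_eq_natCast_pow`
  obtain ⟨𝔐, h𝔐⟩ := v.localPrimesAbove_nonempty
  set ψ : AlgebraicClosure (v.adicCompletion ℚ) ≃ₐ[v.adicCompletion ℚ] AlgebraicClosure (v.adicCompletion ℚ) :=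
    absoluteGaloisGroup.toAlgEquiv _ σ with hψ
  have hσI' : σ ∈ 𝔐.inertia (absoluteGaloisGroup (v.adicCompletion ℚ)) := by
    rw [inertia_eq_absInertia (specVal_spec v) h𝔐]; exact hσ
  have hσI : ∀ z, specVal v z ≤ 1 → specVal v (ψ z - z) < 1 :=
    (mem_inertia_iff_spectralValuation (specVal_spec v) h𝔐).1 hσI'
  haveI : CharZero (AlgebraicClosure (v.adicCompletion ℚ)) :=
    charZero_of_injective_algebraMap (algebraMap ℚ _).injective
  have hp0 : (p : AlgebraicClosure (v.adicCompletion ℚ)) ≠ 0 := Nat.cast_ne_zero.mpr hp.out.ne_zero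
  have hu0 : u ≠ 0 := by
    intro h
    rw [h, zero_pow he0] at hu
    exact pow_ne_zero m hp0 hu.symm
  have hψp : ψ ((p : AlgebraicClosure (v.adicCompletion ℚ)) ^ m) = (p : _) ^ m := by
    rw [map_pow, map_natCast]
  -- `ζ = σ(u)/u`, an `e`-th root of unity
  set ζ : AlgebraicClosure (v.adicCompletion ℚ) := ψ u * u⁻¹ with hζ
  have hψu : ψ u = ζ * u := by rw [hζ, inv_mul_cancel_right₀ hu0]
  have hζe : ζ ^ e = 1 := by
    rw [hζ, mul_pow, ← map_pow, hu, hψp, inv_pow, hu, mul_inv_cancel₀ (pow_ne_zero m hp0)]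
  have hwζ : specVal v ζ = 1 := by
    have h : specVal v ζ ^ e = 1 := by rw [← map_pow, hζe, map_one]
    exact ((pow_eq_one_iff.mp h).resolve_right he0)
  have hζ0 : ζ ≠ 0 := fun h ↦ by
    rw [h, zero_pow he0] at hζe; exact zero_ne_one hζe
  -- `σ(ζ) = ζ`
  have hψζ : ψ ζ = ζ := by
    set η : AlgebraicClosure (v.adicCompletion ℚ) := ψ ζ * ζ⁻¹ with hη
    have hηe : η ^ e = 1 := by
      rw [hη, mul_pow, ← map_pow, hζe, map_one, inv_pow, hζe, inv_one, mul_one]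
    have hη1 : specVal v (η - 1) < 1 := by
      have h1 : η - 1 = (ψ ζ - ζ) * ζ⁻¹ := by
        rw [hη, sub_mul, mul_inv_cancel₀ hζ0]
      rw [h1, map_mul, map_inv₀, hwζ, inv_one, mul_one]
      exact hσI ζ hwζ.le
    have hη' : η = 1 := eq_one_of_pow_eq_one_of_specVal_sub_one_lt p hpv he0 hηe hη1 hpe
    have : ψ ζ = η * ζ := by rw [hη, inv_mul_cancel_right₀ hζ0]
    rw [this, hη', one_mul]
  -- `σ^k(u) = ζ^k u`
  have hiter : ∀ k : ℕ, (ψ ^ k) u = ζ ^ k * u := by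
    intro k
    induction k with
    | zero => rw [pow_zero, pow_zero, one_mul, AlgEquiv.one_apply]
    | succ k ih =>
      rw [pow_succ', AlgEquiv.mul_apply, ih, map_mul, map_pow, hψζ, hψu, pow_succ]
      ring
  refine ⟨ζ, hζe, hwζ, ?_, fun k ↦ ?_⟩
  · rw [absoluteGaloisGroup.smul_def, ← hψ, hψζ]
  · rw [absoluteGaloisGroup.smul_def, map_pow, ← hψ, hiter k]

end Local

end Summit.BirchSwinnertonDyer.Rank1Residual.Additive.GoodModelLine

end
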